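import Literature.Computability.AlgebraicComplexity.AndrewsForbes2022PfaffianReductionGauss

/-!
# Proof of Andrews–Forbes 2022, Proposition 4.2 (`AndrewsForbes2022_prop_4_2_holds`)

Discharges the named fact `AndrewsForbes2022_prop_4_2` (`AndrewsForbes2022DeterminantalIdeals.lean`;
AF22 Prop. 4.2, p0026:L23): for a nonzero `f` in the Pfaffian ideal `I^Pf_{2n,2r}` there is an
invertible `P` over `𝔽(ε)`, `q ∈ ℤ`, `α ∈ 𝔽^×` and a shape `σ` with even parts and `σ₁ ≥ 2r` such
that `f(P X Pᵀ) = ε^q α [K_σ](X) + O(ε^{q+1})`, `[K_σ] = ∏ Pf(X_{[σᵢ],[σᵢ]})`.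

## The argument

The printed proof (Lemma 4.1 + the Pfaffian straightening law, Thm. 2.33) is replaced — exactly as
the tree's proof of Prop. 3.5 (`BideterminantReductionProofs.lean`) replaces Lemma 3.4 +
straightening — by highest-weight theory for the congruence action `f(X) ↦ f(A X Aᵀ)` of
`GL_{2n}(𝔽)`, transported to the square-matrix toolkit through the equivariant embedding
`ρ : f ↦ f(Y - Yᵀ)` (`AndrewsForbes2022PfaffianReductionWeights.lean`):

1. `q` = the least symmetric digit weight `∑_i μ_i b^i` (`μ` = index multiplicity, `b = 2 deg f + 2`)
   of a monomial of a translate `f(A X Aᵀ)`, `A` invertible (`𝔽` infinite); `h_S` = the weight-`q`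
   component of that translate, `h = ρ h_S` the weight-`q` component of `(ρ f)(A Y Aᵀ)`.
2. `h(L Y Lᵀ) = h(Y)` for lower unitriangular `L` (filtered substitution + minimality).
3. `h` vanishes at the upper parts of all `A' S_k A'ᵀ`, `S_k` the standard alternating matrix of
   rank `2k < 2r` (the `2r`-Pfaffians do: `Pf² = det` and a rank count).
4. `μ` is non-increasing (a transposition of indices is a translate of smaller weight).
5. Identification: over the fraction field of `𝔽[x]`, skew Gauss (`exists_lower_congr_eq_dtilde`)
   gives `L̂ X L̂ᵀ = ⊕ ((0,δᵢ),(-δᵢ,0))`, whence `h_S = c · ∏ δᵢ^{μ_{2i}}` by Step 2 and torus scaling,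
   `Pf(X_{[2k]}) = δ₀ ⋯ δ_{k-1}`, so `h_S = c · ∏_k Pf(X_{[2k+2]})^{μ_{2k} - μ_{2k+2}} = c · [K_σ]`.
6. `σ₁ ≥ 2r` from Step 3 at `S_{r-1}`.
7. `P = A · diag(ε^{b^i})`: `f(P X Pᵀ) = ∑_e f_A,e ε^{⟨w,e⟩} x^e = ε^q h_S + O(ε^{q+1})`.

Everything is proved for every INFINITE field (`AndrewsForbes2022_prop_4_2_of_infinite`); the named
fact (characteristic zero) is the special case.  No new definitions of mathematical notions beyond
proof devices; no new named facts.  Honest framing: VP ≠ VNP is NOT proved.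

## References
* [AndrewsForbes2022] R. Andrews, M. A. Forbes, arXiv:2112.00792, §4.1: Lemma 4.1 (p0025:L27),
  Prop. 4.2 (p0026:L23, proof L32–L80), Cor. 2.31 / Thm. 2.33 (the roles replaced here).
-/

noncomputable section

namespace Literature.Computability.AlgebraicComplexity

namespace PfaffianReduction

open MvPolynomial Matrix AndrewsForbes

variable {F : Type*} [Field F] {N : ℕ}

/-! ### Pfaffians under evaluation -/

/-- `evS M` commutes with Pfaffians of matrices of skew polynomials.
(proof plumbing) [cite: AndrewsForbes2022, Prop. 4.2 (proof)] -/
theorem evS_pfaffian {S' : Type*} [CommRing S'] [Algebra F S'] (M : Matrix (Fin N) (Fin N) S')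
    {k : ℕ} (A : Matrix (Fin k) (Fin k) (MvPolynomial (SkewVarIdx N) F)) :
    evS M (pfaffian k A) = pfaffian k (A.map (evS M)) := by
  rw [pfaffian_eq_matrixPfaffian, pfaffian_eq_matrixPfaffian]
  exact (Literature.LinearAlgebra.Matrix.pfaffian_map (evS (F := F) M).toRingHom A).symm

/-- `f(A X Aᵀ)` at a generator: `evS M (Pf(X_{ρ,ρ})) = Pf(M_{ρ,ρ})` for `M` alternating.
(proof plumbing) [cite: AndrewsForbes2022, Prop. 4.2 (proof)] -/
theorem evS_pfaffian_submatrix {S' : Type*} [CommRing S'] [Algebra F S'] (M : Matrix (Fin N) (Fin N) S')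
    (hM : Mᵀ = -M) (hd : ∀ i, M i i = 0) {k : ℕ} (ρ γ : Fin k → Fin N) :
    evS M (pfaffian k ((skewX F N).submatrix ρ γ)) = pfaffian k (M.submatrix ρ γ) := by
  rw [evS_pfaffian, ← Matrix.submatrix_map, skewX_map_evS M hM hd]

/-- The Pfaffian of an alternating matrix with vanishing determinant vanishes (`det = Pf²`).
(proof plumbing) [cite: AndrewsForbes2022, §2.6] -/
theorem pfaffian_eq_zero_of_det_eq_zero {K : Type*} [Field K] {k : ℕ} (M : Matrix (Fin k) (Fin k) K)
    (hM : Mᵀ = -M) (hd : ∀ i, M i i = 0) (h : M.det = 0) : pfaffian k M = 0 := by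
  rw [Literature.LinearAlgebra.Matrix.det_eq_pfaffian_sq M hM hd] at h
  rw [pfaffian_eq_matrixPfaffian]
  exact pow_eq_zero_iff (n := 2) (by norm_num) |>.mp h

/-! ### Step 3 (first half): the vanishing ideal of the rank-`2k` test matrices -/

variable (F) in
/-- The polynomials in `𝔽[Y]` vanishing at the upper parts `A' U_k A'ᵀ` of all congruence images of
the standard alternating matrix of rank `2k` (`U_k` its upper part). [cite: AndrewsForbes2022, Prop. 4.2 (proof)] -/
def skewVanishIdeal (N k : ℕ) : Ideal (MvPolynomial (Fin N × Fin N) F) :=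
  ⨅ A' : Matrix (Fin N) (Fin N) F,
    RingHom.ker (ev (A' * upperPart (dtilde N (indWt (R := F) k)) * A'ᵀ))

/-- Membership in `skewVanishIdeal`. (proof plumbing) [cite: AndrewsForbes2022, Prop. 4.2 (proof)] -/
theorem mem_skewVanishIdeal_iff {k : ℕ} {p : MvPolynomial (Fin N × Fin N) F} :
    p ∈ skewVanishIdeal F N k ↔
      ∀ A' : Matrix (Fin N) (Fin N) F, ev (A' * upperPart (dtilde N (indWt (R := F) k)) * A'ᵀ) p = 0 := by
  simp only [skewVanishIdeal, Ideal.mem_iInf, RingHom.mem_ker]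

/-- `P U Pᵀ - (P U Pᵀ)ᵀ = P M Pᵀ` for `U` the upper part of the alternating matrix `M`.
(proof plumbing) [cite: AndrewsForbes2022, Prop. 4.2 (proof)] -/
theorem congr_upperPart_sub_transpose {S' : Type*} [CommRing S'] (P M : Matrix (Fin N) (Fin N) S')
    (hM : Mᵀ = -M) (hd : ∀ i, M i i = 0) :
    P * upperPart M * Pᵀ - (P * upperPart M * Pᵀ)ᵀ = P * M * Pᵀ := by
  rw [transpose_mul, transpose_mul, transpose_transpose, ← Matrix.mul_assoc, Matrix.mul_assoc P,
    Matrix.mul_assoc P, ← Matrix.mul_sub, ← Matrix.sub_mul, upperPart_sub_transpose _ hM hd,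
    Matrix.mul_assoc]

/-- The test point: `A' U_k A'ᵀ - (A' U_k A'ᵀ)ᵀ = A' S_k A'ᵀ`. (proof plumbing) [cite: AndrewsForbes2022, Prop. 4.2 (proof)] -/
theorem testMatrix_sub_transpose {S' : Type*} [CommRing S'] {k : ℕ} (A' : Matrix (Fin N) (Fin N) S') :
    A' * upperPart (dtilde N (indWt (R := S') k)) * A'ᵀ - (A' * upperPart (dtilde N (indWt (R := S') k)) * A'ᵀ)ᵀ =
      A' * dtilde N (indWt (R := S') k) * A'ᵀ :=
  congr_upperPart_sub_transpose _ _ (dtilde_transpose _ _) (dtilde_apply_self _ _)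

/-- **`ρ(I^Pf_{2n,2r}) ⊆ skewVanishIdeal k` for `k < r`**: the `2r`-Pfaffians vanish at congruence
images of the rank-`2k` standard matrix (`Pf² = det`, and the image factors through `𝔽^{2k}`).
[cite: AndrewsForbes2022, Prop. 4.2 (proof) with Cor. 2.31] -/
theorem rho_mem_skewVanishIdeal {n r k : ℕ} (hk : k < r) (hrn : r ≤ n)
    {f : MvPolynomial (SkewVarIdx (2 * n)) F} (hf : f ∈ pfaffIdeal F n r) :
    rho f ∈ skewVanishIdeal F (2 * n) k := by
  rw [pfaffIdeal] at hf
  have hle : Ideal.span {p : MvPolynomial (SkewVarIdx (2 * n)) F |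
      ∃ ρ : Fin (2 * r) ↪o Fin (2 * n), p = pfaffian (2 * r) ((skewX F (2 * n)).submatrix ρ ρ)} ≤
      (skewVanishIdeal F (2 * n) k).comap (rho (F := F) (N := 2 * n)).toRingHom := by
    rw [Ideal.span_le]
    rintro p ⟨ρ, rfl⟩
    rw [SetLike.mem_coe, Ideal.mem_comap, AlgHom.toRingHom_eq_coe, RingHom.coe_coe,
      mem_skewVanishIdeal_iff]
    intro A'
    rw [ev_rho, testMatrix_sub_transpose,
      evS_pfaffian_submatrix _ (transpose_mul_mul_transpose_of_alt A' _ (dtilde_transpose _ _))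
        (mul_mul_transpose_apply_self_of_alt A' _ (dtilde_transpose _ _) (dtilde_apply_self _ _))]
    have hsub : (A' * dtilde (2 * n) (indWt (R := F) k) * A'ᵀ).submatrix ρ ρ =
        A'.submatrix ρ id * dtilde (2 * n) (indWt (R := F) k) * (A'.submatrix ρ id)ᵀ := by
      rw [transpose_submatrix, Matrix.submatrix_mul _ _ _ id _ Function.bijective_id,
        Matrix.submatrix_mul _ _ _ id _ Function.bijective_id, submatrix_id_id]
    rw [hsub]
    refine pfaffian_eq_zero_of_det_eq_zero _
      (transpose_mul_mul_transpose_of_alt _ _ (dtilde_transpose _ _))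
      (mul_mul_transpose_apply_self_of_alt _ _ (dtilde_transpose _ _) (dtilde_apply_self _ _)) ?_
    exact det_congr_dtilde_indWt_eq_zero (by omega) (by omega) _
  exact hle hf

/-- `skewVanishIdeal` is stable under congruence translates. (proof plumbing) [cite: AndrewsForbes2022, Prop. 4.2 (proof)] -/
theorem transl_mem_skewVanishIdeal {k : ℕ} {p : MvPolynomial (Fin N × Fin N) F}
    (hp : p ∈ skewVanishIdeal F N k) (A : Matrix (Fin N) (Fin N) F) :
    transl A Aᵀ p ∈ skewVanishIdeal F N k := by
  rw [mem_skewVanishIdeal_iff] at hp ⊢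
  intro A'
  rw [ev_transl, map_algebraMap_self, map_algebraMap_self]
  have : A * (A' * upperPart (dtilde N (indWt (R := F) k)) * A'ᵀ) * Aᵀ =
      (A * A') * upperPart (dtilde N (indWt (R := F) k)) * (A * A')ᵀ := by
    rw [transpose_mul]; simp only [Matrix.mul_assoc]
  rw [this]
  exact hp _

/-- `skewVanishIdeal` is stable under coefficients of the symmetric torus family (its values at
`t₀ ≠ 0` are congruence translates by diagonal matrices). (proof plumbing) [cite: AndrewsForbes2022, Prop. 4.2 (proof)] -/
theorem coeff_twist_mem_skewVanishIdeal [Infinite F] {k b : ℕ} {p : MvPolynomial (Fin N × Fin N) F}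
    (hp : p ∈ skewVanishIdeal F N k) (q : ℕ) :
    (twist (sdwt N b) p).coeff q ∈ skewVanishIdeal F N k := by
  rw [mem_skewVanishIdeal_iff]
  intro A'
  have := apply_coeff_eq_zero_of_forall_eval (twist (sdwt N b) p)
    ((ev (A' * upperPart (dtilde N (indWt (R := F) k)) * A'ᵀ) :
      MvPolynomial (Fin N × Fin N) F →ₐ[F] F).toLinearMap) (fun t₀ _ => ?_) q
  · simpa using this
  · rw [AlgHom.toLinearMap_apply, sdwt_eq,
      eval_twist (fun i : Fin N => b ^ (i : ℕ)) (fun j : Fin N => b ^ (j : ℕ))]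
    have h := transl_mem_skewVanishIdeal hp (diagonal fun i : Fin N => t₀ ^ b ^ (i : ℕ))
    rw [diagonal_transpose] at h
    exact (mem_skewVanishIdeal_iff.mp h) A'


/-! ### Step 1: the minimal symmetric weight -/

/-- `f(1·X·1ᵀ) = f`. (proof plumbing) [cite: AndrewsForbes2022, Prop. 4.2 (proof)] -/
theorem translS_one (f : MvPolynomial (SkewVarIdx N) F) :
    translS (1 : Matrix (Fin N) (Fin N) F) f = f := by
  rw [translS, Matrix.map_one C (map_zero C) (map_one C), Matrix.one_mul, transpose_one,
    Matrix.mul_one, evS_skewX]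

/-- The entries of the generic skew matrix have total degree `≤ 1`. (proof plumbing) [cite: AndrewsForbes2022, Prop. 4.2 (proof)] -/
theorem totalDegree_skewX_le (i j : Fin N) : (skewX F N i j).totalDegree ≤ 1 := by
  simp only [skewX, of_apply]
  split_ifs
  · exact (totalDegree_X _).le
  · rw [totalDegree_neg]; exact (totalDegree_X _).le
  · simp

/-- Congruence translates do not raise the total degree. (proof plumbing) [cite: AndrewsForbes2022, Prop. 4.2 (proof)] -/
theorem totalDegree_translS_le (A : Matrix (Fin N) (Fin N) F) (f : MvPolynomial (SkewVarIdx N) F) :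
    (translS A f).totalDegree ≤ f.totalDegree := by
  rw [translS]
  refine totalDegree_evS_le _ (fun i j => ?_) f
  simp only [Matrix.mul_apply, transpose_apply, Matrix.map_apply]
  refine (totalDegree_finsetSum _ _).trans (Finset.sup_le fun k _ => ?_)
  refine (totalDegree_mul _ _).trans ?_
  rw [totalDegree_C, add_zero]
  refine (totalDegree_finsetSum _ _).trans (Finset.sup_le fun l _ => ?_)
  refine (totalDegree_mul _ _).trans ?_
  rw [totalDegree_C, zero_add]
  exact totalDegree_skewX_le l k

/-- Index multiplicities of monomials of a translate are `≤ deg f`. (proof plumbing) [cite: AndrewsForbes2022, Prop. 4.2 (proof)] -/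
theorem smult_le_of_mem_support_translS (f : MvPolynomial (SkewVarIdx N) F) (A : Matrix (Fin N) (Fin N) F)
    {e : SkewVarIdx N →₀ ℕ} (he : e ∈ (translS A f).support) (i : Fin N) : smult e i ≤ f.totalDegree := by
  have hdeg : e.degree ≤ f.totalDegree := by
    refine le_trans ?_ (totalDegree_translS_le A f)
    have := MvPolynomial.le_totalDegree he
    rwa [Finsupp.degree_eq_sum, ← Finsupp.sum_fintype e (fun _ k => k) (by simp)]
  exact (smult_le_degree e i).trans hdeg

/-- Row-plus-column weights of monomials of `(ρ f)(A Y B)` are `≤ 2 deg f`. (proof plumbing) [cite: AndrewsForbes2022, Prop. 4.2 (proof)] -/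
theorem rowColWt_le_of_mem_support_translRho (f : MvPolynomial (SkewVarIdx N) F)
    (A B : Matrix (Fin N) (Fin N) F) {d : Fin N × Fin N →₀ ℕ} (hd : d ∈ (transl A B (rho f)).support)
    (i : Fin N) : rowWt d i + colWt d i ≤ 2 * f.totalDegree := by
  have hdeg : d.degree ≤ f.totalDegree := by
    refine le_trans ?_ ((totalDegree_transl_le A B _).trans (totalDegree_rho_le f))
    have := MvPolynomial.le_totalDegree hd
    rwa [Finsupp.degree_eq_sum, ← Finsupp.sum_fintype d (fun _ k => k) (by simp)]
  exact (rowColWt_le_two_mul_degree d i).trans (by omega)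

/-- **Existence of the extremal datum** (skew version of the tree's `exists_min_weight`): for
`f ≠ 0` there are a weight `q`, an invertible `A` and a monomial `e₀` of `f(A X Aᵀ)` of symmetric
digit weight `q` such that no monomial of any invertible congruence translate of `f` has smaller
weight. (proof plumbing) [cite: AndrewsForbes2022, Prop. 4.2 (proof)] -/
theorem exists_min_weightS (b : ℕ) {f : MvPolynomial (SkewVarIdx N) F} (hf : f ≠ 0) :
    ∃ (q : ℕ) (A : Matrix (Fin N) (Fin N) F) (e₀ : SkewVarIdx N →₀ ℕ),
      IsUnit A.det ∧ e₀ ∈ (translS A f).support ∧ Finsupp.weight (sdwtS N b) e₀ = q ∧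
      ∀ A' : Matrix (Fin N) (Fin N) F, IsUnit A'.det →
        ∀ e ∈ (translS A' f).support, q ≤ Finsupp.weight (sdwtS N b) e := by
  classical
  let P : ℕ → Prop := fun d => ∃ (A : Matrix (Fin N) (Fin N) F) (e : SkewVarIdx N →₀ ℕ),
    IsUnit A.det ∧ e ∈ (translS A f).support ∧ Finsupp.weight (sdwtS N b) e = d
  have hP : ∃ d, P d := by
    obtain ⟨e, he⟩ := Finset.nonempty_iff_ne_empty.mpr (MvPolynomial.support_eq_empty.not.mpr hf)
    exact ⟨_, 1, e, by simp, by rwa [translS_one], rfl⟩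
  refine ⟨Nat.find hP, ?_⟩
  obtain ⟨A, e₀, hA, he₀, hw⟩ := Nat.find_spec hP
  exact ⟨A, e₀, hA, he₀, hw, fun A' hA' e he => Nat.find_min' hP ⟨A', e, hA', he, rfl⟩⟩

section Extremal

/-! Throughout: `b` a base, `q` the minimal symmetric weight (hypothesis `hmin`), `A` invertible,
`T = f(A X Aᵀ)`, `h_S` its weight-`q` component and `h = ρ h_S = coeff_q twist((ρ f)(A Y Aᵀ))`. -/

variable {b q : ℕ} {f : MvPolynomial (SkewVarIdx N) F} {A : Matrix (Fin N) (Fin N) F}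

/-- Minimality transported through `ρ`: monomials of `(ρ f)(A' Y A'ᵀ)` have weight `≥ q`. (proof plumbing) [cite: AndrewsForbes2022, Prop. 4.2 (proof)] -/
theorem le_weight_of_mem_support_translRho
    (hmin : ∀ A' : Matrix (Fin N) (Fin N) F, IsUnit A'.det →
      ∀ e ∈ (translS A' f).support, q ≤ Finsupp.weight (sdwtS N b) e)
    (A' : Matrix (Fin N) (Fin N) F) (hA' : IsUnit A'.det) {d : Fin N × Fin N →₀ ℕ}
    (hd : d ∈ (transl A' A'ᵀ (rho f)).support) : q ≤ Finsupp.weight (sdwt N b) d := by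
  rw [← rho_translS] at hd
  obtain ⟨e, he, hwe⟩ := exists_weight_eq_of_mem_support_rho b _ hd
  rw [hwe]
  exact hmin A' hA' e he

/-- `h = ρ h_S`: the square-side initial form is `ρ` of the weight-`q` component of `f(A X Aᵀ)`.
(proof plumbing) [cite: AndrewsForbes2022, Prop. 4.2 (proof)] -/
theorem init_eq_rho_initS (b q : ℕ) (A : Matrix (Fin N) (Fin N) F) (f : MvPolynomial (SkewVarIdx N) F) :
    (twist (sdwt N b) (transl A Aᵀ (rho f))).coeff q =
      rho (weightedHomogeneousComponent (sdwtS N b) q (translS A f)) := by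
  rw [coeff_twist_eq_weightedHomogeneousComponent, ← rho_translS, rho_weightedHomogeneousComponent]

/-- `h_S ≠ 0` (it contains `e₀`). (proof plumbing) [cite: AndrewsForbes2022, Prop. 4.2 (proof)] -/
theorem initS_ne_zero {e₀ : SkewVarIdx N →₀ ℕ} (he₀ : e₀ ∈ (translS A f).support)
    (hw₀ : Finsupp.weight (sdwtS N b) e₀ = q) :
    weightedHomogeneousComponent (sdwtS N b) q (translS A f) ≠ 0 := by
  classical
  intro h0
  have := congrArg (MvPolynomial.coeff e₀) h0
  rw [coeff_weightedHomogeneousComponent, if_pos hw₀, coeff_zero] at this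
  exact (mem_support_iff.mp he₀) this

/-- `h ≠ 0`. (proof plumbing) [cite: AndrewsForbes2022, Prop. 4.2 (proof)] -/
theorem init_ne_zero' {e₀ : SkewVarIdx N →₀ ℕ} (he₀ : e₀ ∈ (translS A f).support)
    (hw₀ : Finsupp.weight (sdwtS N b) e₀ = q) :
    (twist (sdwt N b) (transl A Aᵀ (rho f))).coeff q ≠ 0 := by
  rw [init_eq_rho_initS]
  intro h0
  exact initS_ne_zero he₀ hw₀ (rho_injective (by rw [h0, map_zero]))

/-- All monomials of `h_S` have the index multiplicities of `e₀` (digits in base `b > deg f`).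
[cite: AndrewsForbes2022, Prop. 4.2 (proof: separation of multidegrees)] -/
theorem smult_eq_of_mem_support_initS (hbf : f.totalDegree + 1 ≤ b) {e₀ e : SkewVarIdx N →₀ ℕ}
    (he₀ : e₀ ∈ (translS A f).support) (hw₀ : Finsupp.weight (sdwtS N b) e₀ = q)
    (he : e ∈ (weightedHomogeneousComponent (sdwtS N b) q (translS A f)).support) :
    smult e = smult e₀ := by
  have he' : e ∈ (translS A f).support :=
    mem_support_of_mem_support_weightedHomogeneousComponent _ _ _ he
  have hwe : Finsupp.weight (sdwtS N b) e = q :=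
    weight_eq_of_mem_support_weightedHomogeneousComponent _ _ _ he
  exact smult_eq_of_weight_eq (by omega)
    (fun i => lt_of_le_of_lt (smult_le_of_mem_support_translS f A he' i) (by omega))
    (fun i => lt_of_le_of_lt (smult_le_of_mem_support_translS f A he₀ i) (by omega)) (hwe.trans hw₀.symm)

/-- All monomials of `h` have row-plus-column weights equal to the index multiplicities of `e₀`.
[cite: AndrewsForbes2022, Prop. 4.2 (proof: separation of multidegrees)] -/
theorem rowColWt_eq_smult_of_mem_support_init (hbf : 2 * f.totalDegree + 1 ≤ b)
    {e₀ : SkewVarIdx N →₀ ℕ} (he₀ : e₀ ∈ (translS A f).support)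
    (hw₀ : Finsupp.weight (sdwtS N b) e₀ = q) {d : Fin N × Fin N →₀ ℕ}
    (hd : d ∈ ((twist (sdwt N b) (transl A Aᵀ (rho f))).coeff q).support) :
    (fun i => rowWt d i + colWt d i) = smult e₀ := by
  obtain ⟨hd', hwd⟩ := mem_support_coeff_twist hd
  exact (smult_eq_rowColWt_of_weight_eq (by omega)
    (fun i => lt_of_le_of_lt (smult_le_of_mem_support_translS f A he₀ i) (by omega))
    (fun i => lt_of_le_of_lt (rowColWt_le_of_mem_support_translRho f A Aᵀ hd' i) (by omega))
    (hw₀.trans hwd.symm)).symm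

/-! ### Step 2: invariance under lower unitriangular congruence -/

/-- The weight of a single variable. (proof plumbing) [cite: AndrewsForbes2022, Prop. 4.2 (proof)] -/
theorem weight_sdwt_single (b : ℕ) (kl : Fin N × Fin N) :
    Finsupp.weight (sdwt N b) (Finsupp.single kl 1) = b ^ (kl.1 : ℕ) + b ^ (kl.2 : ℕ) := by
  simp [Finsupp.weight_apply, sdwt]

/-- The congruence substitution `Y ↦ L Y Lᵀ` moves `y_{i,j}` by variables of smaller symmetric
weight when `L` is lower unitriangular. (proof plumbing) [cite: AndrewsForbes2022, Prop. 4.2 (proof)] -/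
theorem transl_congr_X_sub_mem (hb : 2 ≤ b) (L : Matrix (Fin N) (Fin N) F)
    (hL : L.BlockTriangular OrderDual.toDual) (hLd : ∀ i, L i i = 1) (ij : Fin N × Fin N) :
    transl L Lᵀ (X ij) - X ij ∈ lowerPart F (sdwt N b) (sdwt N b ij) := by
  classical
  obtain ⟨i, j⟩ := ij
  have hX : transl L Lᵀ (X (i, j)) =
      ∑ kl : Fin N × Fin N, C (L i kl.1 * L j kl.2) * (X kl : MvPolynomial (Fin N × Fin N) F) := by
    rw [transl_apply, ev_X, Fintype.sum_prod_type]
    simp only [Matrix.mul_apply, Matrix.map_apply, transpose_apply, mvPolynomialX_apply,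
      Finset.sum_mul, map_mul]
    rw [Finset.sum_comm]
    refine Finset.sum_congr rfl fun k _ => Finset.sum_congr rfl fun l _ => by ring
  have hXi : (X (i, j) : MvPolynomial (Fin N × Fin N) F) = C (L i (i, j).1 * L j (i, j).2) * X (i, j) := by
    rw [hLd, hLd, one_mul, C_1, one_mul]
  rw [hX, hXi, ← Finset.sum_erase_eq_sub (Finset.mem_univ (i, j))]
  refine Submodule.sum_mem _ fun kl hkl => ?_
  obtain ⟨k, l⟩ := kl
  rw [Finset.mem_erase] at hkl
  by_cases hik : i < k
  · rw [hL (show OrderDual.toDual k < OrderDual.toDual i from hik), zero_mul, C_0, zero_mul]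
    exact Submodule.zero_mem _
  by_cases hjl : j < l
  · rw [hL (show OrderDual.toDual l < OrderDual.toDual j from hjl), mul_zero, C_0, zero_mul]
    exact Submodule.zero_mem _
  rw [← smul_eq_C_mul]
  refine Submodule.smul_mem _ _ ?_
  rw [lowerPart, show (X (k, l) : MvPolynomial (Fin N × Fin N) F) = monomial (Finsupp.single (k, l) 1) 1
    from rfl, monomial_mem_restrictSupport]
  left
  simp only [Set.mem_setOf_eq, weight_sdwt_single, sdwt]
  have hki : (k : ℕ) ≤ i := Fin.le_def.mp (not_lt.mp hik)
  have hlj : (l : ℕ) ≤ j := Fin.le_def.mp (not_lt.mp hjl)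
  have h1 : b ^ (k : ℕ) ≤ b ^ (i : ℕ) := Nat.pow_le_pow_right (by omega) hki
  have h2 : b ^ (l : ℕ) ≤ b ^ (j : ℕ) := Nat.pow_le_pow_right (by omega) hlj
  rcases hki.lt_or_eq with hki' | hki'
  · have : b ^ (k : ℕ) < b ^ (i : ℕ) := Nat.pow_lt_pow_right (by omega) hki'
    omega
  · rcases hlj.lt_or_eq with hlj' | hlj'
    · have : b ^ (l : ℕ) < b ^ (j : ℕ) := Nat.pow_lt_pow_right (by omega) hlj'
      omega
    · exact absurd (Prod.ext (Fin.ext hki') (Fin.ext hlj')) hkl.1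

/-- **Weights of congruence translates of the initial form stay `≥ q`**: every monomial of
`h(A₁ Y A₁ᵀ)` (`A₁` invertible) has weight `≥ q`, since it is the `t^q`-coefficient of a family
whose values at `t₀ ≠ 0` are translates of `ρ f` by the invertible `A · diag(t₀^{b^i}) · A₁`.
(proof plumbing) [cite: AndrewsForbes2022, Prop. 4.2 (proof)] -/
theorem le_weight_of_mem_support_transl_init' [Infinite F]
    (hmin : ∀ A' : Matrix (Fin N) (Fin N) F, IsUnit A'.det →
      ∀ e ∈ (translS A' f).support, q ≤ Finsupp.weight (sdwtS N b) e)
    (hA : IsUnit A.det) (A₁ : Matrix (Fin N) (Fin N) F) (hA₁ : IsUnit A₁.det) {d : Fin N × Fin N →₀ ℕ}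
    (hd : d ∈ (transl A₁ A₁ᵀ ((twist (sdwt N b) (transl A Aᵀ (rho f))).coeff q)).support) :
    q ≤ Finsupp.weight (sdwt N b) d := by
  by_contra hlt
  push Not at hlt
  set w := sdwt N b with hw
  set P := (twist w (transl A Aᵀ (rho f))).map
    (transl A₁ A₁ᵀ : MvPolynomial (Fin N × Fin N) F →+* MvPolynomial (Fin N × Fin N) F) with hP
  have hcoeff : P.coeff q = transl A₁ A₁ᵀ ((twist w (transl A Aᵀ (rho f))).coeff q) := by
    rw [hP, Polynomial.coeff_map]
    rfl
  have hzero := apply_coeff_eq_zero_of_forall_eval P (coeffL d) (fun t₀ ht₀ => ?_) q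
  · rw [coeffL_apply, hcoeff] at hzero
    exact (mem_support_iff.mp hd) hzero
  · rw [coeffL_apply, hP, eval_map_twist, hw, sdwt_eq,
      eval_twist (fun i : Fin N => b ^ (i : ℕ)) (fun j : Fin N => b ^ (j : ℕ)),
      transl_transl, transl_transl]
    by_contra hne
    have hmem := MvPolynomial.mem_support_iff.mpr hne
    have h1 : IsUnit (A * ((diagonal fun i : Fin N => t₀ ^ (b ^ (i : ℕ))) * A₁)).det := by
      rw [det_mul, det_mul]
      exact hA.mul ((isUnit_det_diagonal_pow ht₀ (fun i : Fin N => b ^ (i : ℕ))).mul hA₁)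
    have hT : A₁ᵀ * (diagonal fun j : Fin N => t₀ ^ (b ^ (j : ℕ))) * Aᵀ =
        (A * ((diagonal fun i : Fin N => t₀ ^ (b ^ (i : ℕ))) * A₁))ᵀ := by
      rw [transpose_mul, transpose_mul, diagonal_transpose]
    rw [hT] at hmem
    exact absurd (le_weight_of_mem_support_translRho hmin _ h1 hmem) (not_le.mpr hlt)

/-- **Invariance under lower unitriangular congruence** `h(L Y Lᵀ) = h(Y)`. (proof plumbing) [cite: AndrewsForbes2022, Prop. 4.2 (proof)] -/
theorem transl_congr_init_eq [Infinite F] (hb : 2 ≤ b)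
    (hmin : ∀ A' : Matrix (Fin N) (Fin N) F, IsUnit A'.det →
      ∀ e ∈ (translS A' f).support, q ≤ Finsupp.weight (sdwtS N b) e)
    (hA : IsUnit A.det) (L : Matrix (Fin N) (Fin N) F) (hL : L.BlockTriangular OrderDual.toDual)
    (hLd : ∀ i, L i i = 1) :
    transl L Lᵀ ((twist (sdwt N b) (transl A Aᵀ (rho f))).coeff q) =
      (twist (sdwt N b) (transl A Aᵀ (rho f))).coeff q := by
  refine eq_of_filtered (transl L Lᵀ) (transl_congr_X_sub_mem hb L hL hLd) _
    (fun e he => (mem_support_coeff_twist he).2) fun e he => ?_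
  refine le_weight_of_mem_support_transl_init' hmin hA L ?_ he
  rw [det_eq_one_of_lower L hL hLd]
  exact isUnit_one

/-- The invariance at `𝔽`-points, in the form consumed by `ev_congr_eq_of_forall`. (proof plumbing) [cite: AndrewsForbes2022, Prop. 4.2 (proof)] -/
theorem ev_congr_init_eq [Infinite F] (hb : 2 ≤ b)
    (hmin : ∀ A' : Matrix (Fin N) (Fin N) F, IsUnit A'.det →
      ∀ e ∈ (translS A' f).support, q ≤ Finsupp.weight (sdwtS N b) e)
    (hA : IsUnit A.det) :
    ∀ (L : Matrix (Fin N) (Fin N) F), L.BlockTriangular OrderDual.toDual → (∀ i, L i i = 1) →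
      ev ((L.map C : Matrix (Fin N) (Fin N) (MvPolynomial (Fin N × Fin N) F)) *
        mvPolynomialX (Fin N) (Fin N) F *
        (L.map C : Matrix (Fin N) (Fin N) (MvPolynomial (Fin N × Fin N) F))ᵀ)
        ((twist (sdwt N b) (transl A Aᵀ (rho f))).coeff q) =
      (twist (sdwt N b) (transl A Aᵀ (rho f))).coeff q := by
  intro L hL hLd
  rw [← transpose_map]
  exact transl_congr_init_eq hb hmin hA L hL hLd

/-! ### Step 3 (second half): the initial form vanishes on the test matrices -/

/-- `h ∈ skewVanishIdeal k` for `k < r` when `f ∈ I^Pf_{2n,2r}`. [cite: AndrewsForbes2022, Prop. 4.2 (proof)] -/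
theorem init_mem_skewVanishIdeal [Infinite F] {n r k : ℕ} (hk : k < r) (hrn : r ≤ n)
    {f : MvPolynomial (SkewVarIdx (2 * n)) F} (hf : f ∈ pfaffIdeal F n r)
    (A : Matrix (Fin (2 * n)) (Fin (2 * n)) F) (b q : ℕ) :
    (twist (sdwt (2 * n) b) (transl A Aᵀ (rho f))).coeff q ∈ skewVanishIdeal F (2 * n) k :=
  coeff_twist_mem_skewVanishIdeal (transl_mem_skewVanishIdeal (rho_mem_skewVanishIdeal hk hrn hf) A) q

/-! ### Step 4: dominance of the index multiplicities -/

/-- **Dominance.** The index multiplicity `μ = smult e₀` of the extremal monomial is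
non-increasing: otherwise the simultaneous swap of two indices (a congruence translate) produces a
monomial of smaller symmetric weight. (proof plumbing) [cite: AndrewsForbes2022, Prop. 4.2 (proof)] -/
theorem smult_antitone (hb : 2 ≤ b) (hbf : 2 * f.totalDegree + 1 ≤ b)
    (hmin : ∀ A' : Matrix (Fin N) (Fin N) F, IsUnit A'.det →
      ∀ e ∈ (translS A' f).support, q ≤ Finsupp.weight (sdwtS N b) e)
    (hA : IsUnit A.det) {e₀ : SkewVarIdx N →₀ ℕ} (he₀ : e₀ ∈ (translS A f).support)
    (hw₀ : Finsupp.weight (sdwtS N b) e₀ = q) {i i' : Fin N} (hii' : i < i') :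
    smult e₀ i' ≤ smult e₀ i := by
  classical
  by_contra hlt
  push Not at hlt
  obtain ⟨d₀, hd₀⟩ := Finset.nonempty_iff_ne_empty.mpr
    (MvPolynomial.support_eq_empty.not.mpr (init_ne_zero' he₀ hw₀))
  have hν := rowColWt_eq_smult_of_mem_support_init hbf he₀ hw₀ hd₀
  have hνi : ∀ a, rowWt d₀ a + colWt d₀ a = smult e₀ a := fun a => congrFun hν a
  obtain ⟨hd₀', hwd₀⟩ := mem_support_coeff_twist hd₀
  let τ : Equiv.Perm (Fin N) := Equiv.swap i i'
  let g : Fin N × Fin N → Fin N × Fin N := fun ij => (τ ij.1, τ ij.2)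
  have hinj : Function.Injective g := by
    intro x y hxy
    simp only [g, Prod.mk.injEq] at hxy
    exact Prod.ext (τ.injective hxy.1) (τ.injective hxy.2)
  let d₁ := Finsupp.mapDomain g d₀
  -- `d₁` occurs in a translate
  have hmem : d₁ ∈ (transl (A * τ.permMatrix F) (A * τ.permMatrix F)ᵀ (rho f)).support := by
    rw [transpose_mul, ← transl_transl, transl_perm, support_rename_of_injective hinj]
    exact Finset.mem_image_of_mem _ hd₀'
  have hτ : IsUnit (A * τ.permMatrix F).det := by
    rw [det_mul, det_permutation]
    refine hA.mul ?_
    rcases Int.units_eq_one_or (Equiv.Perm.sign τ) with h | h <;> simp [h]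
  have hq := le_weight_of_mem_support_translRho hmin _ hτ hmem
  -- but its weight is smaller
  have hνswap : ∀ a, rowWt d₁ a + colWt d₁ a = rowWt d₀ (τ a) + colWt d₀ (τ a) := by
    intro a
    have := rowColWt_mapDomain_perm τ d₀ (τ a)
    simp only [τ, Equiv.swap_apply_self] at this
    simpa [d₁, g, τ] using this
  have hsplit : ∀ φ : Fin N → ℕ, ∑ a, φ a = φ i + (φ i' + ∑ a ∈ (Finset.univ.erase i).erase i', φ a) := by
    intro φ
    rw [Finset.add_sum_erase _ _ (Finset.mem_erase.mpr ⟨hii'.ne', Finset.mem_univ _⟩),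
      Finset.add_sum_erase _ _ (Finset.mem_univ _)]
  have hrest : ∑ a ∈ (Finset.univ.erase i).erase i', (rowWt d₁ a + colWt d₁ a) * b ^ (a : ℕ) =
      ∑ a ∈ (Finset.univ.erase i).erase i', (rowWt d₀ a + colWt d₀ a) * b ^ (a : ℕ) := by
    refine Finset.sum_congr rfl fun a ha => ?_
    simp only [Finset.mem_erase] at ha
    rw [hνswap a]
    simp [τ, Equiv.swap_apply_of_ne_of_ne ha.2.1 ha.1]
  have hlt' : Finsupp.weight (sdwt N b) d₁ < Finsupp.weight (sdwt N b) d₀ := by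
    rw [weight_sdwt, weight_sdwt, hsplit (fun a => (rowWt d₁ a + colWt d₁ a) * b ^ (a : ℕ)),
      hsplit (fun a => (rowWt d₀ a + colWt d₀ a) * b ^ (a : ℕ)), hrest, hνswap i, hνswap i']
    simp only [τ, Equiv.swap_apply_left, Equiv.swap_apply_right]
    have hpow : b ^ (i : ℕ) < b ^ (i' : ℕ) := Nat.pow_lt_pow_right (by omega) (Fin.lt_def.mp hii')
    rw [hνi i, hνi i']
    have := digit_swap_lt hlt hpow
    omega
  rw [hwd₀] at hlt'
  exact absurd hq (not_le.mpr hlt')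

end Extremal

/-! ### Torus scaling and evaluation lemmas -/

/-- `evS` of a monomial. (proof plumbing) [cite: AndrewsForbes2022, Prop. 4.2 (proof)] -/
theorem evS_monomial {S' : Type*} [CommRing S'] [Algebra F S'] (M : Matrix (Fin N) (Fin N) S')
    (e : SkewVarIdx N →₀ ℕ) (c : F) :
    evS M (monomial e c) = algebraMap F S' c * ∏ p : SkewVarIdx N, M p.1.1 p.1.2 ^ e p := by
  rw [evS, aeval_monomial, Finsupp.prod_fintype _ _ (by simp)]

/-- `∏_p a_{p₁}^{e_p} = ∏_i a_i^{#occurrences of i as first index}`. (proof plumbing) [cite: AndrewsForbes2022, Prop. 4.2 (proof)] -/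
theorem prod_pow_fst_idx {M : Type*} [CommMonoid M] (a : Fin N → M) (e : SkewVarIdx N →₀ ℕ) :
    ∏ p : SkewVarIdx N, a p.1.1 ^ e p = ∏ i, a i ^ (∑ p : SkewVarIdx N, if p.1.1 = i then e p else 0) := by
  simp only [← Finset.prod_pow_eq_pow_sum]
  rw [Finset.prod_comm]
  refine Finset.prod_congr rfl fun p _ => ?_
  rw [Finset.prod_eq_single p.1.1]
  · rw [if_pos rfl]
  · intro i _ hi
    rw [if_neg (Ne.symm hi), pow_zero]
  · intro h
    exact absurd (Finset.mem_univ _) h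

/-- `∏_p a_{p₂}^{e_p} = ∏_i a_i^{#occurrences of i as second index}`. (proof plumbing) [cite: AndrewsForbes2022, Prop. 4.2 (proof)] -/
theorem prod_pow_snd_idx {M : Type*} [CommMonoid M] (a : Fin N → M) (e : SkewVarIdx N →₀ ℕ) :
    ∏ p : SkewVarIdx N, a p.1.2 ^ e p = ∏ i, a i ^ (∑ p : SkewVarIdx N, if p.1.2 = i then e p else 0) := by
  simp only [← Finset.prod_pow_eq_pow_sum]
  rw [Finset.prod_comm]
  refine Finset.prod_congr rfl fun p _ => ?_
  rw [Finset.prod_eq_single p.1.2]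
  · rw [if_pos rfl]
  · intro i _ hi
    rw [if_neg (Ne.symm hi), pow_zero]
  · intro h
    exact absurd (Finset.mem_univ _) h

/-- `∏_p (a_{p₁} a_{p₂})^{e_p} = ∏_i a_i^{μ_i(e)}`. (proof plumbing) [cite: AndrewsForbes2022, Prop. 4.2 (proof)] -/
theorem prod_pow_smult {M : Type*} [CommMonoid M] (a : Fin N → M) (e : SkewVarIdx N →₀ ℕ) :
    ∏ p : SkewVarIdx N, (a p.1.1 * a p.1.2) ^ e p = ∏ i, a i ^ smult e i := by
  simp only [mul_pow, Finset.prod_mul_distrib, smult, pow_add, prod_pow_fst_idx, prod_pow_snd_idx]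

/-- **Torus scaling.** If every monomial of `p` has index multiplicity `μ`, then
`p(D_a M D_a) = a^μ · p(M)` (`D_a = diag(a)`). (proof plumbing) [cite: AndrewsForbes2022, Prop. 4.2 (proof)] -/
theorem evS_diagonal_mul_mul_diagonal {S' : Type*} [CommRing S'] [Algebra F S'] (a : Fin N → S')
    (M : Matrix (Fin N) (Fin N) S') (p : MvPolynomial (SkewVarIdx N) F) (μ : Fin N → ℕ)
    (hp : ∀ e ∈ p.support, smult e = μ) :
    evS (diagonal a * M * diagonal a) p = (∏ i, a i ^ μ i) * evS M p := by
  conv_lhs => rw [p.as_sum]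
  conv_rhs => rw [p.as_sum]
  rw [map_sum, map_sum, Finset.mul_sum]
  refine Finset.sum_congr rfl fun e he => ?_
  rw [evS_monomial, evS_monomial, ← hp e he]
  simp only [mul_diagonal, diagonal_mul]
  have h1 : ∀ q : SkewVarIdx N, a q.1.1 * M q.1.1 q.1.2 * a q.1.2 = (a q.1.1 * a q.1.2) * M q.1.1 q.1.2 :=
    fun q => by ring
  simp only [h1, mul_pow, Finset.prod_mul_distrib]
  have h2 : (∏ q : SkewVarIdx N, a q.1.1 ^ e q) * ∏ q : SkewVarIdx N, a q.1.2 ^ e q = ∏ i, a i ^ smult e i := by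
    rw [← prod_pow_smult, ← Finset.prod_mul_distrib]
    exact Finset.prod_congr rfl fun q _ => by rw [mul_pow]
  rw [h2]
  ring

/-- `dtilde δ = D_a · dtilde 1 · D_a` with `a = (δ₀, 1, δ₁, 1, …)`. (proof plumbing) [cite: AndrewsForbes2022, Prop. 4.2 (proof)] -/
theorem dtilde_eq_diagonal_mul_mul_diagonal {R : Type*} [CommRing R] (m : ℕ) (δ : ℕ → R) :
    dtilde m δ = diagonal (fun i : Fin m => if (i : ℕ) % 2 = 0 then δ (i / 2) else 1) *
      dtilde m (fun _ => (1 : R)) * diagonal (fun i : Fin m => if (i : ℕ) % 2 = 0 then δ (i / 2) else 1) := by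
  ext i j
  simp only [mul_diagonal, diagonal_mul, dtilde_apply]
  by_cases h1 : (j : ℕ) = i + 1 ∧ (i : ℕ) % 2 = 0
  · rw [if_pos h1, if_pos h1, if_pos h1.2, if_neg (show ¬ ((j : ℕ) % 2 = 0) by omega)]
    ring
  · rw [if_neg h1, if_neg h1]
    by_cases h2 : (i : ℕ) = j + 1 ∧ (j : ℕ) % 2 = 0
    · rw [if_pos h2, if_pos h2, if_pos h2.2, if_neg (show ¬ ((i : ℕ) % 2 = 0) by omega)]
      ring
    · rw [if_neg h2, if_neg h2]
      ring

/-- `dtilde` commutes with maps of scalars. (proof plumbing) [cite: AndrewsForbes2022, Prop. 4.2 (proof)] -/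
theorem dtilde_map {R S' : Type*} [CommRing R] [CommRing S'] (φ : R → S') (h0 : φ 0 = 0)
    (hneg : ∀ x, φ (-x) = -φ x) (m : ℕ) (δ : ℕ → R) :
    (dtilde m δ).map φ = dtilde m (fun i => φ (δ i)) := by
  ext i j
  simp only [Matrix.map_apply, dtilde_apply]
  split_ifs <;> simp [h0, hneg]

/-- A product over `range (2n)` split into even and odd indices. (proof plumbing) [cite: AndrewsForbes2022, Prop. 4.2 (proof)] -/
theorem prod_range_two_mul {M : Type*} [CommMonoid M] (g : ℕ → M) (n : ℕ) :
    ∏ m ∈ Finset.range (2 * n), g m = ∏ k ∈ Finset.range n, (g (2 * k) * g (2 * k + 1)) := by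
  induction n with
  | zero => simp
  | succ n ih =>
    rw [show 2 * (n + 1) = 2 * n + 1 + 1 by ring, Finset.prod_range_succ, Finset.prod_range_succ, ih,
      Finset.prod_range_succ, mul_assoc]

/-- `evS` at the generic skew matrix pushed along an algebra map is that map. (proof plumbing)
[cite: AndrewsForbes2022, Prop. 4.2 (proof)] -/
theorem evS_map_skewX {S' : Type*} [CommRing S'] [Algebra F S']
    (ψ : MvPolynomial (SkewVarIdx N) F →ₐ[F] S') (p : MvPolynomial (SkewVarIdx N) F) :
    evS ((skewX F N).map ψ) p = ψ p := by
  rw [← map_evS, evS_skewX]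

/-- Pfaffians (this file's recursion) commute with ring maps. (proof plumbing) [cite: AndrewsForbes2022, §2.6] -/
theorem pfaffian_map' {R S' : Type*} [CommRing R] [CommRing S'] (φ : R →+* S') {k : ℕ}
    (A : Matrix (Fin k) (Fin k) R) : pfaffian k (A.map φ) = φ (pfaffian k A) := by
  rw [pfaffian_eq_matrixPfaffian, pfaffian_eq_matrixPfaffian, Literature.LinearAlgebra.Matrix.pfaffian_map]

/-- `Pf(g A gᵀ) = det g · Pf(A)` for this file's recursion. [cite: AndrewsForbes2022, Prop. 4.2 (proof: "Pf(D_{[k]} X_{[k]} Dᵀ_{[k]}) = det(D_{[k]}) Pf_k(X)")] -/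
theorem pfaffian_congr {R : Type*} [CommRing R] {k : ℕ} (A g : Matrix (Fin k) (Fin k) R)
    (hA : Aᵀ = -A) (hd : ∀ i, A i i = 0) : pfaffian k (g * A * gᵀ) = g.det * pfaffian k A := by
  rw [pfaffian_eq_matrixPfaffian, pfaffian_eq_matrixPfaffian,
    Literature.LinearAlgebra.Matrix.pfaffian_mul_mul_transpose A g hA hd]

/-- Principal submatrices of alternating matrices are alternating. (proof plumbing) [cite: AndrewsForbes2022, Prop. 4.2 (proof)] -/
theorem submatrix_transpose_of_alt {R : Type*} [CommRing R] {ι κ : Type*} (Z : Matrix ι ι R)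
    (hZ : Zᵀ = -Z) (e : κ → ι) : (Z.submatrix e e)ᵀ = -Z.submatrix e e := by
  ext i j
  have := congrFun (congrFun hZ (e i)) (e j)
  simp only [transpose_apply, Matrix.neg_apply] at this
  simp only [transpose_apply, submatrix_apply, Matrix.neg_apply, this]

/-- The leading Pfaffians of the generic skew matrix are nonzero (evaluate at `dtilde 1`). (proof plumbing) [cite: AndrewsForbes2022, Prop. 4.2 (proof)] -/
theorem pfaffian_skewX_corner_ne_zero {n k : ℕ} (hk : 2 * k ≤ 2 * n) :
    pfaffian (2 * k) ((skewX F (2 * n)).submatrix (Fin.castLE hk) (Fin.castLE hk)) ≠ 0 := by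
  intro h0
  have := congrArg (evS (F := F) (dtilde (2 * n) (indWt (R := F) n))) h0
  rw [evS_pfaffian_submatrix _ (dtilde_transpose _ _) (dtilde_apply_self _ _),
    pfaffian_dtilde_indWt_corner k n hk, if_pos (by omega), map_zero] at this
  exact one_ne_zero this

/-- `evS M (Pf_s(X)) = Pf(M_{[s],[s]})`. (proof plumbing) [cite: AndrewsForbes2022, Prop. 4.2 (proof)] -/
theorem evS_leadingPfaffian {S' : Type*} [CommRing S'] [Algebra F S'] (M : Matrix (Fin N) (Fin N) S')
    (hM : Mᵀ = -M) (hd : ∀ i, M i i = 0) {s : ℕ} (hs : s ≤ N) :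
    evS M (leadingPfaffian F N s) = pfaffian s (M.submatrix (Fin.castLE hs) (Fin.castLE hs)) := by
  rw [leadingPfaffian, dif_pos hs, evS_pfaffian_submatrix M hM hd]

/-! ### Step 5: identification of `h_S` with `c · [K_σ](X)` -/

/-- `smult e`, extended by zero to all natural indices. (proof plumbing) [cite: AndrewsForbes2022, Prop. 4.2 (proof)] -/
def smult' (e : SkewVarIdx N →₀ ℕ) (i : ℕ) : ℕ := if h : i < N then smult e ⟨i, h⟩ else 0

/-- `smult'` below `N`. (proof plumbing) [cite: AndrewsForbes2022, Prop. 4.2 (proof)] -/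
theorem smult'_of_lt (e : SkewVarIdx N →₀ ℕ) {i : ℕ} (hi : i < N) : smult' e i = smult e ⟨i, hi⟩ := by
  rw [smult', dif_pos hi]

/-- `smult'` from `N` on. (proof plumbing) [cite: AndrewsForbes2022, Prop. 4.2 (proof)] -/
theorem smult'_of_le (e : SkewVarIdx N →₀ ℕ) {i : ℕ} (hi : N ≤ i) : smult' e i = 0 := by
  rw [smult', dif_neg (not_lt.mpr hi)]

/-- `[K_σ]` of the multiset `∑_k ν_k • {2(k+1)}` is `∏_k Pf(X_{[2k+2]})^{ν_k}`. (proof plumbing) [cite: AndrewsForbes2022, Prop. 4.2 (proof)] -/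
theorem kPfaffMonomial_sum_replicate (ν : ℕ → ℕ) (p : ℕ) :
    kPfaffMonomial F N (∑ k ∈ Finset.range p, Multiset.replicate (ν k) (2 * (k + 1))) =
      ∏ k ∈ Finset.range p, leadingPfaffian F N (2 * (k + 1)) ^ ν k := by
  induction p with
  | zero => simp [kPfaffMonomial]
  | succ p ih =>
    rw [Finset.sum_range_succ, Finset.prod_range_succ, kPfaffMonomial, Multiset.map_add,
      Multiset.prod_add, ← kPfaffMonomial, ih, Multiset.map_replicate, Multiset.prod_replicate]

section Identification

variable {n : ℕ} {b q : ℕ} {f : MvPolynomial (SkewVarIdx (2 * n)) F}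
  {A : Matrix (Fin (2 * n)) (Fin (2 * n)) F}

/-- **Identification of the initial form** (the replacement for Lemma 4.1 + Pfaffian straightening):
`h_S = c · ∏_k Pf(X_{[2k+2]})^{μ_{2k} - μ_{2k+2}}` with `c = h_S(dtilde 1) ≠ 0` and `μ` the
(non-increasing, eventually zero) index multiplicity of `e₀`.
[cite: AndrewsForbes2022, Prop. 4.2 (with Lemma 4.1)] -/
theorem initS_eq_C_mul_prod [Infinite F] (hb : 2 ≤ b) (hbf : 2 * f.totalDegree + 1 ≤ b)
    (hmin : ∀ A' : Matrix (Fin (2 * n)) (Fin (2 * n)) F, IsUnit A'.det →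
      ∀ e ∈ (translS A' f).support, q ≤ Finsupp.weight (sdwtS (2 * n) b) e)
    (hA : IsUnit A.det) {e₀ : SkewVarIdx (2 * n) →₀ ℕ}
    (he₀ : e₀ ∈ (translS A f).support) (hw₀ : Finsupp.weight (sdwtS (2 * n) b) e₀ = q) :
    ∃ c : F, c ≠ 0 ∧ (∀ k, smult' e₀ (2 * (k + 1)) ≤ smult' e₀ (2 * k)) ∧
      weightedHomogeneousComponent (sdwtS (2 * n) b) q (translS A f) =
        C c * ∏ k ∈ Finset.range n,
          leadingPfaffian F (2 * n) (2 * (k + 1)) ^ (smult' e₀ (2 * k) - smult' e₀ (2 * (k + 1))) := by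
  classical
  set hS := weightedHomogeneousComponent (sdwtS (2 * n) b) q (translS A f) with hhSdef
  have hh : (twist (sdwt (2 * n) b) (transl A Aᵀ (rho f))).coeff q = rho hS := init_eq_rho_initS b q A f
  have hS0 : hS ≠ 0 := initS_ne_zero he₀ hw₀
  have hsm : ∀ e ∈ hS.support, smult e = smult e₀ := fun e he =>
    smult_eq_of_mem_support_initS (by omega) he₀ hw₀ he
  have hinvF := ev_congr_init_eq hb hmin hA (f := f) (q := q)
  have hanti : ∀ i i' : Fin (2 * n), i < i' → smult e₀ i' ≤ smult e₀ i := fun i i' hii' =>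
    smult_antitone hb hbf hmin hA he₀ hw₀ hii'
  -- the numerical test matrix and `c`
  set c : F := evS (dtilde (2 * n) (fun _ => (1 : F))) hS with hcdef
  -- the fraction field of `𝔽[x]`
  let Rb := MvPolynomial (SkewVarIdx (2 * n)) F
  let 𝕂 := FractionRing Rb
  have hinjR : Function.Injective (algebraMap Rb 𝕂) := IsFractionRing.injective Rb 𝕂
  let ι : Rb →ₐ[F] 𝕂 := IsScalarTower.toAlgHom F Rb 𝕂
  have hι : (ι : Rb → 𝕂) = algebraMap Rb 𝕂 := rfl
  let Zh : Matrix (Fin (2 * n)) (Fin (2 * n)) 𝕂 := (skewX F (2 * n)).map ι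
  have hZt : Zhᵀ = -Zh := by
    ext i j
    have := congrFun (congrFun (skewX_transpose (R := F) (2 * n)) i) j
    simp only [transpose_apply, Matrix.neg_apply] at this
    simp only [Zh, transpose_apply, Matrix.map_apply, Matrix.neg_apply, this, map_neg]
  have hZd : ∀ i, Zh i i = 0 := fun i => by
    simp only [Zh, Matrix.map_apply, skewX_apply_self, map_zero]
  have hevZ : ∀ p : Rb, evS Zh p = ι p := fun p => evS_map_skewX ι p
  have hZ : ∀ k (hk : 2 * k ≤ 2 * n),
      pfaffian (2 * k) (Zh.submatrix (Fin.castLE hk) (Fin.castLE hk)) ≠ 0 := by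
    intro k hk
    rw [← evS_pfaffian_submatrix (F := F) Zh hZt hZd, hevZ, hι, map_ne_zero_iff _ hinjR]
    exact pfaffian_skewX_corner_ne_zero hk
  obtain ⟨Lh, δ, hLt, hLd, hLZ⟩ := exists_lower_congr_eq_dtilde n Zh hZt hZd hZ
  -- invariance transported to `𝕂`: `h_S(dtilde δ) = ι(h_S)`
  have hinvK : ev (Lh * upperPart Zh * Lhᵀ) (rho hS) = ev (upperPart Zh) (rho hS) := by
    have := ev_congr_eq_of_forall _ hinvF Lh hLt hLd (upperPart Zh)
    rwa [hh] at this
  rw [ev_upperPart_rho _ hZt hZd, ev_rho, congr_upperPart_sub_transpose _ _ hZt hZd, hLZ, hevZ] at hinvK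
  -- scaling: `h_S(dtilde δ) = ∏ a_i^{μ_i} · c`
  have hmat1 : (dtilde (2 * n) (fun _ => (1 : F))).map (Algebra.ofId F 𝕂) = dtilde (2 * n) (fun _ => (1 : 𝕂)) := by
    rw [dtilde_map _ (map_zero _) (map_neg _)]
    simp only [map_one]
  have hE1 : ι hS = (∏ i : Fin (2 * n), (if (i : ℕ) % 2 = 0 then δ (i / 2) else 1) ^ smult e₀ i) *
      algebraMap F 𝕂 c := by
    rw [← hinvK, dtilde_eq_diagonal_mul_mul_diagonal (2 * n) δ,
      evS_diagonal_mul_mul_diagonal _ _ hS (smult e₀) hsm]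
    congr 1
    rw [hcdef, show algebraMap F 𝕂 (evS (dtilde (2 * n) fun _ => (1 : F)) hS) =
      (Algebra.ofId F 𝕂) (evS (dtilde (2 * n) fun _ => (1 : F)) hS) from rfl, map_evS, hmat1]
  -- `c ≠ 0`
  have hc : c ≠ 0 := by
    intro hc0
    apply hS0
    apply hinjR
    rw [← hι, hE1, hc0, map_zero, mul_zero, map_zero]
  -- leading Pfaffians in `𝕂`
  have hpf : ∀ k, k ≤ n → ι (leadingPfaffian F (2 * n) (2 * k)) = ∏ i ∈ Finset.range k, δ i := by
    intro k hk
    have hk2 : 2 * k ≤ 2 * n := by omega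
    rw [← hevZ, evS_leadingPfaffian Zh hZt hZd hk2]
    have hUt : Lhᵀ.BlockTriangular id := fun i j hij => hLt (OrderDual.toDual_lt_toDual.mpr hij)
    have h1 := submatrix_mul_mul_castLE Lh Zh Lhᵀ hLt hUt hk2 hk2
    rw [hLZ, dtilde_submatrix_castLE, ← transpose_submatrix] at h1
    have h2 := congrArg (pfaffian (2 * k)) h1
    rw [pfaffian_dtilde, pfaffian_congr _ _ (submatrix_transpose_of_alt Zh hZt (Fin.castLE hk2))
        (fun i => hZd _), det_corner_eq_one_of_lower Lh hLt hLd hk2, one_mul] at h2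
    exact h2.symm
  -- bookkeeping with natural indices
  let μ' : ℕ → ℕ := fun k => smult' e₀ (2 * k)
  have hμ'anti : ∀ k, μ' (k + 1) ≤ μ' k := by
    intro k
    by_cases hk1 : 2 * (k + 1) < 2 * n
    · have hk0 : 2 * k < 2 * n := by omega
      simp only [μ', smult'_of_lt e₀ hk1, smult'_of_lt e₀ hk0]
      exact hanti ⟨2 * k, hk0⟩ ⟨2 * (k + 1), hk1⟩ (Fin.mk_lt_mk.mpr (by omega))
    · simp only [μ', smult'_of_le e₀ (not_lt.mp hk1)]
      exact Nat.zero_le _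
  have hμ'n : μ' n = 0 := smult'_of_le e₀ le_rfl
  have hprod : ∏ i : Fin (2 * n), (if (i : ℕ) % 2 = 0 then δ (i / 2) else 1) ^ smult e₀ i =
      ∏ k ∈ Finset.range n, δ k ^ μ' k := by
    have h1 : ∀ i : Fin (2 * n), (if (i : ℕ) % 2 = 0 then δ (i / 2) else 1) ^ smult e₀ i =
        (fun m : ℕ => (if m % 2 = 0 then δ (m / 2) else (1 : 𝕂)) ^ smult' e₀ m) i := by
      intro i
      simp only [smult'_of_lt e₀ i.2]
    rw [Finset.prod_congr rfl fun i _ => h1 i,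
      Fin.prod_univ_eq_prod_range (fun m : ℕ => (if m % 2 = 0 then δ (m / 2) else (1 : 𝕂)) ^ smult' e₀ m)
        (2 * n), prod_range_two_mul]
    refine Finset.prod_congr rfl fun k _ => ?_
    have e1 : (2 * k) % 2 = 0 := by omega
    have e2 : ¬ (2 * k + 1) % 2 = 0 := by omega
    have e3 : 2 * k / 2 = k := by omega
    simp only [e1, e2, e3, if_true, if_false, one_pow, mul_one, μ']
  have hE2 : ι hS = algebraMap F 𝕂 c * ∏ k ∈ Finset.range n, δ k ^ μ' k := by
    rw [hE1, hprod, mul_comm]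
  have hE3 : ι (∏ k ∈ Finset.range n,
      leadingPfaffian F (2 * n) (2 * (k + 1)) ^ (μ' k - μ' (k + 1))) = ∏ k ∈ Finset.range n, δ k ^ μ' k := by
    rw [map_prod]
    have h1 : ∀ k ∈ Finset.range n, ι (leadingPfaffian F (2 * n) (2 * (k + 1)) ^ (μ' k - μ' (k + 1))) =
        (∏ i ∈ Finset.range (k + 1), δ i) ^ (μ' k - μ' (k + 1)) := by
      intro k hk
      rw [map_pow, hpf (k + 1) (Finset.mem_range.mp hk)]
    rw [Finset.prod_congr rfl h1, prod_pow_sub_telescope δ μ' hμ'anti n]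
    refine Finset.prod_congr rfl fun i _ => ?_
    rw [hμ'n, Nat.sub_zero]
  have hιC : ι (C c) = algebraMap F 𝕂 c := by
    rw [hι, ← MvPolynomial.algebraMap_eq, ← IsScalarTower.algebraMap_apply]
  refine ⟨c, hc, hμ'anti, hinjR ?_⟩
  rw [← hι, map_mul, hE3, hE2, hιC]

end Identification

/-! ### Step 6: the largest part is `≥ 2r` -/

/-- **The width bound `σ₁ ≥ 2r`** (the role of Cor. 2.31 in the printed proof): if
`c · ∏_k Pf(X_{[2k+2]})^{ν_k}` with `c ≠ 0` vanishes at the rank-`2(r-1)` test matrix, some `ν_k`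
with `k + 1 ≥ r` is nonzero. [cite: AndrewsForbes2022, Cor. 2.31 / Prop. 4.2] -/
theorem exists_part_ge' {n r : ℕ} (hr : 0 < r) {c : F} (hc : c ≠ 0) (ν : ℕ → ℕ)
    (hv : evS (dtilde (2 * n) (indWt (R := F) (r - 1)))
      (C c * ∏ k ∈ Finset.range n, leadingPfaffian F (2 * n) (2 * (k + 1)) ^ ν k) = 0) :
    ∃ k, k < n ∧ r ≤ k + 1 ∧ ν k ≠ 0 := by
  rw [map_mul, evS_C, Algebra.algebraMap_self, RingHom.id_apply, map_prod] at hv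
  rcases mul_eq_zero.mp hv with h | h
  · exact absurd h hc
  · obtain ⟨k, hk, hk0⟩ := Finset.prod_eq_zero_iff.mp h
    have hkn : k < n := Finset.mem_range.mp hk
    rw [map_pow, evS_leadingPfaffian _ (dtilde_transpose _ _) (dtilde_apply_self _ _)
        (show 2 * (k + 1) ≤ 2 * n by omega),
      pfaffian_dtilde_indWt_corner (k + 1) (r - 1)] at hk0
    obtain ⟨h1, h2⟩ := pow_eq_zero_iff'.mp hk0
    refine ⟨k, hkn, ?_, h2⟩
    by_contra hlt
    push Not at hlt
    rw [if_pos (by omega)] at h1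
    exact one_ne_zero h1

/-! ### Step 7: passage to `ε` -/

section Epsilon

variable {K : Type*} [Field K] [Algebra F K]

/-- The entry of the generic skew matrix at a variable index. (proof plumbing) [cite: AndrewsForbes2022, Prop. 4.2 (proof)] -/
theorem skewX_apply_idx (R : Type*) [CommRing R] (p : SkewVarIdx N) : skewX R N p.1.1 p.1.2 = X p := by
  simp [skewX, p.2]

/-- The `ε`-weighted substitution `x_{ij} ↦ t^{b^i + b^j} x_{ij}` (the congruence by `diag(t^{b^i})`)
over an extension `K` of `𝔽`, on coefficients: `coeff_e = ι(coeff_e p) · t^{⟨w,e⟩}`.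
[cite: AndrewsForbes2022, Prop. 4.2 (proof, the map φ)] -/
theorem coeff_evS_weightSubst (b : ℕ) (t : K) (p : MvPolynomial (SkewVarIdx N) F) (e : SkewVarIdx N →₀ ℕ) :
    MvPolynomial.coeff e (evS (diagonal (fun i : Fin N => (C (t ^ b ^ (i : ℕ)) : MvPolynomial (SkewVarIdx N) K)) *
        skewX K N * diagonal (fun i : Fin N => (C (t ^ b ^ (i : ℕ)) : MvPolynomial (SkewVarIdx N) K))) p) =
      algebraMap F K (MvPolynomial.coeff e p) * t ^ Finsupp.weight (sdwtS N b) e := by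
  classical
  set M := diagonal (fun i : Fin N => (C (t ^ b ^ (i : ℕ)) : MvPolynomial (SkewVarIdx N) K)) *
    skewX K N * diagonal (fun i : Fin N => (C (t ^ b ^ (i : ℕ)) : MvPolynomial (SkewVarIdx N) K)) with hM
  have hentry : ∀ q : SkewVarIdx N, M q.1.1 q.1.2 = C (t ^ sdwtS N b q) * X q := by
    intro q
    rw [hM, mul_diagonal, diagonal_mul, skewX_apply_idx, sdwtS, pow_add, map_mul]
    ring
  have hmon : ∀ (e' : SkewVarIdx N →₀ ℕ) (c : F), evS M (monomial e' c) =
      monomial e' (algebraMap F K c * t ^ Finsupp.weight (sdwtS N b) e') := by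
    intro e' c
    rw [evS_monomial]
    simp only [hentry, mul_pow, Finset.prod_mul_distrib]
    have hX : (∏ q : SkewVarIdx N, (X q : MvPolynomial (SkewVarIdx N) K) ^ e' q) = monomial e' 1 := by
      rw [← MvPolynomial.prod_X_pow_eq_monomial]
      exact (Finset.prod_subset (Finset.subset_univ _) fun x _ hx => by
        rw [Finsupp.notMem_support_iff.mp hx, pow_zero]).symm
    have hC : (∏ q : SkewVarIdx N, (C (t ^ sdwtS N b q) : MvPolynomial (SkewVarIdx N) K) ^ e' q) =
        C (t ^ Finsupp.weight (sdwtS N b) e') := by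
      simp only [← map_pow, ← map_prod, ← pow_mul]
      rw [Finset.prod_pow_eq_pow_sum, Finsupp.weight_apply, Finsupp.sum_fintype _ _ (by simp)]
      simp only [smul_eq_mul, mul_comm]
    rw [hX, hC, MvPolynomial.algebraMap_apply, ← mul_assoc, ← map_mul, C_mul_monomial, mul_one]
  conv_lhs => rw [p.as_sum, map_sum]
  rw [coeff_sum]
  simp only [hmon, coeff_monomial]
  rw [Finset.sum_eq_single e]
  · rw [if_pos rfl]
  · intro e' _ hne
    rw [if_neg hne]
  · intro he
    rw [MvPolynomial.notMem_support_iff.mp he, map_zero, zero_mul, ite_self]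

/-- `skewCongr` is `evS` at `P X Pᵀ`. (proof plumbing) [cite: AndrewsForbes2022, Prop. 4.2 (proof)] -/
theorem skewCongr_eq_evS (P : Matrix (Fin N) (Fin N) K) (p : MvPolynomial (SkewVarIdx N) F) :
    skewCongr P p = evS ((P.map C : Matrix (Fin N) (Fin N) (MvPolynomial (SkewVarIdx N) K)) * skewX K N *
      (P.map C : Matrix (Fin N) (Fin N) (MvPolynomial (SkewVarIdx N) K))ᵀ) p := rfl

/-- The change of variables of the statement, `X ↦ P X Pᵀ` with `P = A · diag(t^{b^i})`, is the
`ε`-weighted substitution applied to the translate `f(A X Aᵀ)`. (proof plumbing) [cite: AndrewsForbes2022, Prop. 4.2 (proof)] -/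
theorem skewCongr_weightSubst (b : ℕ) (t : K) (A : Matrix (Fin N) (Fin N) F) (p : MvPolynomial (SkewVarIdx N) F) :
    skewCongr (A.map (algebraMap F K) * diagonal (fun i : Fin N => t ^ b ^ (i : ℕ))) p =
      evS (diagonal (fun i : Fin N => (C (t ^ b ^ (i : ℕ)) : MvPolynomial (SkewVarIdx N) K)) *
        skewX K N * diagonal (fun i : Fin N => (C (t ^ b ^ (i : ℕ)) : MvPolynomial (SkewVarIdx N) K)))
        (translS A p) := by
  have hMt : (diagonal (fun i : Fin N => (C (t ^ b ^ (i : ℕ)) : MvPolynomial (SkewVarIdx N) K)) *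
      skewX K N * diagonal (fun i : Fin N => (C (t ^ b ^ (i : ℕ)) : MvPolynomial (SkewVarIdx N) K)))ᵀ =
      -(diagonal (fun i : Fin N => (C (t ^ b ^ (i : ℕ)) : MvPolynomial (SkewVarIdx N) K)) *
        skewX K N * diagonal (fun i : Fin N => (C (t ^ b ^ (i : ℕ)) : MvPolynomial (SkewVarIdx N) K))) := by
    rw [transpose_mul, transpose_mul, diagonal_transpose, skewX_transpose, Matrix.neg_mul,
      Matrix.mul_neg, Matrix.mul_assoc]
  have hMd : ∀ i, (diagonal (fun i : Fin N => (C (t ^ b ^ (i : ℕ)) : MvPolynomial (SkewVarIdx N) K)) *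
      skewX K N * diagonal (fun i : Fin N => (C (t ^ b ^ (i : ℕ)) : MvPolynomial (SkewVarIdx N) K))) i i = 0 :=
    fun i => by rw [mul_diagonal, diagonal_mul, skewX_apply_self, mul_zero, zero_mul]
  have hA : (A.map (algebraMap F K)).map (C : K →+* MvPolynomial (SkewVarIdx N) K) =
      A.map (algebraMap F (MvPolynomial (SkewVarIdx N) K)) := by
    rw [Matrix.map_map]
    exact Matrix.ext fun i j => (MvPolynomial.algebraMap_apply (A i j)).symm
  have hmat : ((A.map (algebraMap F K) * diagonal (fun i : Fin N => t ^ b ^ (i : ℕ))).map C :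
        Matrix (Fin N) (Fin N) (MvPolynomial (SkewVarIdx N) K)) * skewX K N *
      ((A.map (algebraMap F K) * diagonal (fun i : Fin N => t ^ b ^ (i : ℕ))).map C :
        Matrix (Fin N) (Fin N) (MvPolynomial (SkewVarIdx N) K))ᵀ =
      A.map (algebraMap F (MvPolynomial (SkewVarIdx N) K)) *
        (diagonal (fun i : Fin N => (C (t ^ b ^ (i : ℕ)) : MvPolynomial (SkewVarIdx N) K)) *
          skewX K N * diagonal (fun i : Fin N => (C (t ^ b ^ (i : ℕ)) : MvPolynomial (SkewVarIdx N) K))) *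
        (A.map (algebraMap F (MvPolynomial (SkewVarIdx N) K)))ᵀ := by
    rw [Matrix.map_mul, diagonal_map (map_zero _), hA, transpose_mul, diagonal_transpose]
    simp only [Matrix.mul_assoc]
  rw [skewCongr_eq_evS, hmat, evS_translS _ hMt hMd]

end Epsilon

end PfaffianReduction

open MvPolynomial Matrix AndrewsForbes PfaffianReduction in
/-- **Andrews–Forbes 2022, Proposition 4.2, over every infinite field**: for `1 ≤ r ≤ n` and a
nonzero `f ∈ I^Pf_{2n,2r}` there are an invertible `P` over `𝔽(ε)`, `q ∈ ℤ`, `α ≠ 0` and a shape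
`σ` (even positive parts `≤ 2n`, `σ₁ ≥ 2r`) with `f(P X Pᵀ) = ε^q α [K_σ](X) + O(ε^{q+1})`.
Proof: Steps 1–7 of the module docstring; `P = A · diag(ε^{b^i})` for the extremal `A ∈ GL_{2n}(𝔽)`,
`b = 2 deg f + 2` (as in the printed proof: `X ↦ M X Mᵀ`, then `x_{i,j} ↦ y^{(2D)^i+(2D)^j} x_{i,j}`,
then `y ↦ ε`). [cite: AndrewsForbes2022, Prop. 4.2] -/
theorem AndrewsForbes2022_prop_4_2_of_infinite (F : Type) [Field F] [Infinite F] (n r : ℕ)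
    (hr : 0 < r) (hrn : r ≤ n) (f : MvPolynomial (SkewVarIdx (2 * n)) F) (hf : f ∈ pfaffIdeal F n r)
    (hf0 : f ≠ 0) :
    ∃ (P : Matrix (Fin (2 * n)) (Fin (2 * n)) (RatFunc F)) (q : ℤ) (α : F) (σ : Multiset ℕ),
      IsUnit P ∧ α ≠ 0 ∧ 2 * r ≤ σ.sup ∧ (∀ s ∈ σ, Even s ∧ 0 < s ∧ s ≤ 2 * n) ∧
      ∀ e : SkewVarIdx (2 * n) →₀ ℕ,
        IsBigOEps F (q + 1) (MvPolynomial.coeff e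
          (skewCongr P f -
            MvPolynomial.C (RatFunc.X ^ q * algebraMap F (RatFunc F) α) *
              MvPolynomial.map (algebraMap F (RatFunc F)) (kPfaffMonomial F (2 * n) σ))) := by
  classical
  obtain ⟨q, A, e₀, hA, he₀, hw₀, hmin⟩ := exists_min_weightS (N := 2 * n) (2 * f.totalDegree + 2) hf0
  obtain ⟨c, hc, hνanti, hh⟩ :=
    initS_eq_C_mul_prod (b := 2 * f.totalDegree + 2) (by omega) (by omega) hmin hA he₀ hw₀
  have hK : kPfaffMonomial F (2 * n) (∑ k ∈ Finset.range n,
      Multiset.replicate (smult' e₀ (2 * k) - smult' e₀ (2 * (k + 1))) (2 * (k + 1))) =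
      ∏ k ∈ Finset.range n, leadingPfaffian F (2 * n) (2 * (k + 1)) ^
        (smult' e₀ (2 * k) - smult' e₀ (2 * (k + 1))) :=
    kPfaffMonomial_sum_replicate _ n
  -- the change of variables `P = A · diag(ε^{b^i})` is invertible
  have hunit : IsUnit (A.map (algebraMap F (RatFunc F)) *
      diagonal (fun i : Fin (2 * n) => (RatFunc.X : RatFunc F) ^ (2 * f.totalDegree + 2) ^ (i : ℕ))) := by
    rw [Matrix.isUnit_iff_isUnit_det, det_mul, det_diagonal, ← RingHom.mapMatrix_apply, ← RingHom.map_det]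
    exact (hA.map _).mul (isUnit_iff_ne_zero.mpr
      (Finset.prod_ne_zero_iff.mpr fun i _ => pow_ne_zero _ RatFunc.X_ne_zero))
  refine ⟨_, (q : ℤ), c, ∑ k ∈ Finset.range n,
    Multiset.replicate (smult' e₀ (2 * k) - smult' e₀ (2 * (k + 1))) (2 * (k + 1)), hunit, hc, ?_, ?_, ?_⟩
  · -- `σ₁ ≥ 2r`: the initial form vanishes at the rank-`2(r-1)` test matrix
    have hv : evS (dtilde (2 * n) (indWt (R := F) (r - 1))) (C c * ∏ k ∈ Finset.range n,
        leadingPfaffian F (2 * n) (2 * (k + 1)) ^ (smult' e₀ (2 * k) - smult' e₀ (2 * (k + 1)))) = 0 := by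
      rw [← hh]
      have hmem := init_mem_skewVanishIdeal (Nat.sub_lt hr Nat.one_pos) hrn hf A (2 * f.totalDegree + 2) q
      have := (mem_skewVanishIdeal_iff.mp hmem) 1
      rwa [Matrix.one_mul, transpose_one, Matrix.mul_one, init_eq_rho_initS,
        ev_upperPart_rho _ (dtilde_transpose _ _) (dtilde_apply_self _ _)] at this
    obtain ⟨k, hkn, hrk, hk0⟩ := exists_part_ge' hr hc _ hv
    have hmemσ : 2 * (k + 1) ∈ ∑ k ∈ Finset.range n,
        Multiset.replicate (smult' e₀ (2 * k) - smult' e₀ (2 * (k + 1))) (2 * (k + 1)) :=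
      Multiset.mem_sum.mpr ⟨k, Finset.mem_range.mpr hkn, Multiset.mem_replicate.mpr ⟨hk0, rfl⟩⟩
    exact le_trans (by omega) (Multiset.le_sup hmemσ)
  · -- all parts are even and lie in `[2, 2n]`
    intro s hs
    obtain ⟨k, hk, hks⟩ := Multiset.mem_sum.mp hs
    obtain ⟨_, rfl⟩ := Multiset.mem_replicate.mp hks
    have := Finset.mem_range.mp hk
    exact ⟨⟨k + 1, by ring⟩, by omega, by omega⟩
  · -- the `ε`-expansion, coefficient by coefficient
    intro e
    rw [skewCongr_weightSubst, coeff_sub, coeff_evS_weightSubst, coeff_C_mul, coeff_map, hK, zpow_natCast]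
    have hhe := congrArg (MvPolynomial.coeff e) hh
    rw [coeff_C_mul, coeff_weightedHomogeneousComponent] at hhe
    by_cases hwe : Finsupp.weight (sdwtS (2 * n) (2 * f.totalDegree + 2)) e = q
    · -- the leading coefficient: exact cancellation
      rw [if_pos hwe] at hhe
      rw [hhe, hwe, map_mul]
      convert isBigOEps_zero (F := F) ((q : ℤ) + 1) using 2
      ring
    · -- all other coefficients are `O(ε^{q+1})`
      rw [if_neg hwe] at hhe
      have hPi : MvPolynomial.coeff e (∏ k ∈ Finset.range n, leadingPfaffian F (2 * n) (2 * (k + 1)) ^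
          (smult' e₀ (2 * k) - smult' e₀ (2 * (k + 1)))) = 0 := by
        rcases mul_eq_zero.mp hhe.symm with h | h
        · exact absurd h hc
        · exact h
      rw [hPi, map_zero, mul_zero, sub_zero]
      by_cases hsupp : e ∈ (translS A f).support
      · have hq := hmin A hA e hsupp
        have hlt : q < Finsupp.weight (sdwtS (2 * n) (2 * f.totalDegree + 2)) e :=
          lt_of_le_of_ne hq (Ne.symm hwe)
        exact isBigOEps_algebraMap_mul_X_pow _ (by exact_mod_cast hlt)
      · rw [MvPolynomial.notMem_support_iff.mp hsupp, map_zero, zero_mul]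
        exact isBigOEps_zero _

open PfaffianReduction in
/-- **Andrews–Forbes 2022, Proposition 4.2** — discharge of the named fact
`AndrewsForbes2022_prop_4_2` (characteristic zero, as vendored; the proof works over every
infinite field, `AndrewsForbes2022_prop_4_2_of_infinite`). [cite: AndrewsForbes2022, Prop. 4.2] -/
theorem AndrewsForbes2022_prop_4_2_holds : AndrewsForbes2022_prop_4_2 := by
  intro F _ _ n r hr hrn f hf hf0
  haveI : Infinite F := Infinite.of_injective (Nat.cast : ℕ → F) Nat.cast_injective
  exact AndrewsForbes2022_prop_4_2_of_infinite F n r hr hrn f hf hf0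

end Literature.Computability.AlgebraicComplexity
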